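import Summits.CriticalPhenomena.PercolationContinuityZ3.Theorems.PercNearOneGluingNoHeavyLowerTailSahiThreeChainOrderThreeBridge
import Summits.CriticalPhenomena.PercolationContinuityZ3.Theorems.PercNearOneGluingNoHeavyLowerTailSahiThreeChainSlotPositivity

/-!
# Sahi's `C₃` in dimension three, IV: `E₃ ≥ 0` on every product of three finite chains — assembly (modulo the slot positivity, and
# unconditionally via `…SlotPositivity`)

Support file of the one-cut programme (crux `NoHeavyLowerTail`, stmt-CriticalPhenomena-4575; cell `prim-masterthm`, seat P3, gen 17;
`run/shared/lean/prim/prim-masterthm/prim-masterthm-p3/HIERARCHY.md` §25; memo `run/shared/lean/prim/prim-masterthm/FROM-prim-masterthm-p3-g17-THREE-CHAINS-C3.md`).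
Third of three files (`…SlotForm`: `T`, trilinearity, axis invariance; `…OrderThreeBridge`: the bridge `sahiE_three_prodWeight3_eq`; this file: positivity and assembly).

* `SahiThreeChain.T f g h` — the ORDER-3 SLOT FORM on `P = Fin 3 × Fin 3 × Fin 3`:
  `T = 16·Σ_z fgh(z) − Σ_{(z,z') non-attacking} [(fg)(z)h(z') + (fh)(z)g(z') + (gh)(z)f(z')] + Σ_{(z₁,z₂,z₃) pairwise non-attacking} f(z₁)g(z₂)h(z₃)`
  (two cells are NON-ATTACKING iff they differ in every coordinate).  `T = (3!)³·Ẽ₃` is the gen-16 without-replacement functional at order 3 in dimension 3; on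
  indicator triples of down-sets it is the integer `Φ` of the slot certificate `…SahiThreeChainSlotCertificate`.
* **`SahiThreeChain.sahiE_three_prodWeight3_eq`** — THE ORDER-3 BRIDGE IN DIMENSION 3: for probability vectors `ν, ν′, ν″` on finite types `α, β, γ` and any
  `f : Fin 3 → α×β×γ → ℝ`,  `E₃^{ν⊗ν′⊗ν″}(f) = (1/216)·Σ_{r,s,t : Fin 3 → α,β,γ} (Πν(r_a))(Πν′(s_b))(Πν″(t_c)) · T(f₀∘π, f₁∘π, f₂∘π)`, `π(a,b,c) = (r_a, s_b, t_c)` —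
  direct proof at order 3 (a `k`-tuple of pairwise non-attacking slots reads `k` independent points: `27·16/216 = 2`, `216/216 = 1`).
* `SahiThreeChain.T_comp_axes` (invariance under relabelling the slots of each axis), `T_lin₀/₁/₂` (trilinearity).
* THE SLOT POSITIVITY HYPOTHESIS `hpos` — the finite statement "`T(1_U,1_V,1_W) ≥ 0` for all down-sets `U,V,W` of `P`" (as an explicit hypothesis of the
  final theorems, no `def`).  It is TRUE: it is exactly what the kernel certificate `SahiThreeChain.slotPhi_nonneg_canon` (`…SlotCertificate`, one `native_decide`
  over `58 205 888` symmetry-reduced triples; also two independent exhaustive C computations over all `157 345 860` multisets) establishes, via the identification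
  `T(1_U,1_V,1_W) = slotPhi(mask U, mask V, mask W)` and the two symmetries of `T` — that identification is `…SlotIdentification` + `…SlotPositivity` (`SahiThreeChain.slotPos`); the `_of_slotPos` forms keep the
  finite hypothesis explicit, the final theorems below discharge it.
* `SahiThreeChain.T_nonneg_of_monotone` — layer cake + trilinearity + axis reversal: `hpos` ⇒ `T ≥ 0` on all nonnegative monotone triples on the slot grid.
* **`SahiThreeChain.sahiE_three_nonneg_prodWeight3_of_slotPos`**, **`sahiPositive_three_prodWeight3_of_slotPos`** — `hpos →` for all finite CHAINS `α, β, γ`, all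
  probability vectors and all nonnegative monotone `f₀,f₁,f₂ : α×β×γ → ℝ` (product order): `0 ≤ E₃^{ν⊗ν′⊗ν″}(f)`, i.e. `SahiPositive (ν⊗ν′⊗ν″) 3` (sorting the slot
  maps by `Tuple.sort` + axis invariance, then `T_nonneg_of_monotone`, then the bridge).  With `hpos` discharged this is Sahi's `C₃` in dimension three /
  Lieb–Sahi's Conjecture 1.1 at `(k,n) = (3,3)` for all product weights.
* **`SahiThreeChain.sahiE_three_nonneg_prodWeight3`**, **`sahiPositive_three_prodWeight3`** — the UNCONDITIONAL forms, `hpos` discharged by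
  `SahiThreeChain.slotPos` (`…SlotPositivity`: the certificate `slotPhi_nonneg_canon` IS the slot positivity).
HONEST LABEL: COMPUTER-ASSISTED KERNEL THEOREM — the unconditional forms rest on the `native_decide` certificate of `…SlotCertificate` (axiom `Lean.ofReduceBool`,
58 205 888 symmetry-reduced slot triples) and the small table checks of `…SlotIdentification/…SlotPositivity`; everything else (bridge, trilinearity, invariance,
layer cake, reductions) is proved with standard axioms.  Sahi's `C_k` / (M⁺-k), `k ≥ 3`, remain OPEN in general (cubes; dimension ≥ 4; order ≥ 4 in dimension 3).  Sahi's `C_k` / (M⁺-k), `k ≥ 3`, remain OPEN in general. [this work]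
-/

noncomputable section

namespace Summit.CriticalPhenomena.PercolationContinuityZ3.Theorems

open Finset Function
open Literature.Combinatorics.Sahi2008

namespace SahiThreeChain

/-! ### Positivity of `T` on monotone arguments, from the slot positivity on down-set indicators -/

section Positivity

/-- The order-reversing relabelling of the slot grid (reverse every axis). [this work] -/
def revAxes : P ≃ P := axes Fin.revPerm Fin.revPerm Fin.revPerm

/-- Reversing every axis is antitone for the product order. [this work] -/
theorem revAxes_antitone : Antitone (revAxes : P → P) := by
  intro z z' h
  simp only [revAxes, axes_apply, Fin.revPerm_apply, Prod.mk_le_mk, Fin.rev_le_rev]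
  exact ⟨h.1, h.2.1, h.2.2⟩

/-- Pull-back of a finite set of cells along the reversal. [this work] -/
def revSet (U : Finset P) : Finset P := univ.filter fun z => revAxes z ∈ U

/-- The indicator of `U` pulled back along the reversal is the indicator of `revSet U`. [this work] -/
theorem setInd_comp_revAxes (U : Finset P) : setInd U ∘ revAxes = setInd (revSet U) := by
  funext z
  simp only [Function.comp_apply, setInd_apply, revSet, Finset.mem_filter, Finset.mem_univ, true_and]

/-- The reversal turns up-sets into down-sets. [this work] -/
theorem isLowerSet_revSet {U : Finset P} (hU : IsUpperSet (U : Set P)) : IsLowerSet ((revSet U : Finset P) : Set P) := by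
  intro z z' hz'z hz
  rw [Finset.mem_coe, revSet, Finset.mem_filter] at hz ⊢
  exact ⟨mem_univ _, hU (revAxes_antitone hz'z) hz.2⟩

/-- From down-sets to up-sets: if `T ≥ 0` on indicator triples of down-sets then also on indicator triples of up-sets (reverse the axes). [this work] -/
theorem T_setInd_nonneg_of_isUpperSet
    (hpos : ∀ U V W : Finset P, IsLowerSet ((U : Finset P) : Set P) → IsLowerSet ((V : Finset P) : Set P) →
      IsLowerSet ((W : Finset P) : Set P) → 0 ≤ T (setInd U) (setInd V) (setInd W))
    (U V W : Finset P) (hU : IsUpperSet ((U : Finset P) : Set P)) (hV : IsUpperSet ((V : Finset P) : Set P))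
    (hW : IsUpperSet ((W : Finset P) : Set P)) : 0 ≤ T (setInd U) (setInd V) (setInd W) := by
  have h := T_comp_axes Fin.revPerm Fin.revPerm Fin.revPerm (setInd U) (setInd V) (setInd W)
  rw [← h]
  change 0 ≤ T (setInd U ∘ revAxes) (setInd V ∘ revAxes) (setInd W ∘ revAxes)
  rw [setInd_comp_revAxes, setInd_comp_revAxes, setInd_comp_revAxes]
  exact hpos _ _ _ (isLowerSet_revSet hU) (isLowerSet_revSet hV) (isLowerSet_revSet hW)

/-- `T` vanishes when the first argument is `0`. [this work] -/
theorem T_zero₀ (g h : P → ℝ) : T 0 g h = 0 := by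
  have e := T_lin₀ 0 0 0 0 g h
  simp only [zero_smul, add_zero, zero_mul] at e
  exact e

/-- `T` vanishes when the second argument is `0`. [this work] -/
theorem T_zero₁ (f h : P → ℝ) : T f 0 h = 0 := by
  have e := T_lin₁ 0 0 f 0 0 h
  simp only [zero_smul, add_zero, zero_mul] at e
  exact e

/-- `T` vanishes when the third argument is `0`. [this work] -/
theorem T_zero₂ (f g : P → ℝ) : T f g 0 = 0 := by
  have e := T_lin₂ 0 0 f g 0 0
  simp only [zero_smul, add_zero, zero_mul] at e
  exact e

/-- Linearity of `T` over a layer-cake list sum, first argument. [this work] -/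
theorem T_listSum₀ (l : List (ℝ × Finset P)) (g h : P → ℝ) :
    T (l.map fun p => p.1 • setInd p.2).sum g h = (l.map fun p => p.1 * T (setInd p.2) g h).sum := by
  induction l with
  | nil => simp [T_zero₀]
  | cons p l ih =>
    rw [List.map_cons, List.sum_cons, List.map_cons, List.sum_cons, ← ih]
    have e := T_lin₀ p.1 1 (setInd p.2) ((l.map fun p => p.1 • setInd p.2).sum) g h
    rw [one_smul, one_mul] at e
    exact e

/-- Linearity of `T` over a layer-cake list sum, second argument. [this work] -/
theorem T_listSum₁ (l : List (ℝ × Finset P)) (f h : P → ℝ) :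
    T f (l.map fun p => p.1 • setInd p.2).sum h = (l.map fun p => p.1 * T f (setInd p.2) h).sum := by
  induction l with
  | nil => simp [T_zero₁]
  | cons p l ih =>
    rw [List.map_cons, List.sum_cons, List.map_cons, List.sum_cons, ← ih]
    have e := T_lin₁ p.1 1 f (setInd p.2) ((l.map fun p => p.1 • setInd p.2).sum) h
    rw [one_smul, one_mul] at e
    exact e

/-- Linearity of `T` over a layer-cake list sum, third argument. [this work] -/
theorem T_listSum₂ (l : List (ℝ × Finset P)) (f g : P → ℝ) :
    T f g (l.map fun p => p.1 • setInd p.2).sum = (l.map fun p => p.1 * T f g (setInd p.2)).sum := by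
  induction l with
  | nil => simp [T_zero₂]
  | cons p l ih =>
    rw [List.map_cons, List.sum_cons, List.map_cons, List.sum_cons, ← ih]
    have e := T_lin₂ p.1 1 f g (setInd p.2) ((l.map fun p => p.1 • setInd p.2).sum)
    rw [one_smul, one_mul] at e
    exact e

/-- **Layer cake**: if `T ≥ 0` on indicator triples of down-sets, then `T(g₀,g₁,g₂) ≥ 0` for all nonnegative monotone `g₀,g₁,g₂` on the slot
grid. [this work] -/
theorem T_nonneg_of_monotone
    (hpos : ∀ U V W : Finset P, IsLowerSet ((U : Finset P) : Set P) → IsLowerSet ((V : Finset P) : Set P) →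
      IsLowerSet ((W : Finset P) : Set P) → 0 ≤ T (setInd U) (setInd V) (setInd W))
    (g₀ g₁ g₂ : P → ℝ) (h₀ : ∀ z, 0 ≤ g₀ z) (h₁ : ∀ z, 0 ≤ g₁ z) (h₂ : ∀ z, 0 ≤ g₂ z)
    (m₀ : Monotone g₀) (m₁ : Monotone g₁) (m₂ : Monotone g₂) : 0 ≤ T g₀ g₁ g₂ := by
  obtain ⟨l₀, hl₀, e₀⟩ := exists_upperSet_decomposition g₀ h₀ m₀
  obtain ⟨l₁, hl₁, e₁⟩ := exists_upperSet_decomposition g₁ h₁ m₁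
  obtain ⟨l₂, hl₂, e₂⟩ := exists_upperSet_decomposition g₂ h₂ m₂
  rw [e₀, T_listSum₀]
  refine List.sum_nonneg fun t ht => ?_
  obtain ⟨p, hp, rfl⟩ := List.mem_map.1 ht
  refine mul_nonneg (hl₀ p hp).1 ?_
  rw [e₁, T_listSum₁]
  refine List.sum_nonneg fun t' ht' => ?_
  obtain ⟨p', hp', rfl⟩ := List.mem_map.1 ht'
  refine mul_nonneg (hl₁ p' hp').1 ?_
  rw [e₂, T_listSum₂]
  refine List.sum_nonneg fun t'' ht'' => ?_
  obtain ⟨p'', hp'', rfl⟩ := List.mem_map.1 ht''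
  exact mul_nonneg (hl₂ p'' hp'').1 (T_setInd_nonneg_of_isUpperSet hpos _ _ _ (hl₀ p hp).2 (hl₁ p' hp').2 (hl₂ p'' hp'').2)

end Positivity

/-! ### Assembly: `E₃ ≥ 0` on every product of three finite chains, modulo the slot positivity -/

section Assembly

variable {α β γ : Type*} [Fintype α] [Fintype β] [Fintype γ] [LinearOrder α] [LinearOrder β] [LinearOrder γ]

omit [Fintype α] [Fintype β] [Fintype γ] in
/-- Sorting the slot maps: `T` of the pull-back along `(r,s,t)` equals `T` of the pull-back along the SORTED maps. [this work] -/
theorem T_slotMap_sort (r : Fin 3 → α) (s : Fin 3 → β) (t : Fin 3 → γ) (f₀ f₁ f₂ : α × β × γ → ℝ) :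
    T (f₀ ∘ slotMap r s t) (f₁ ∘ slotMap r s t) (f₂ ∘ slotMap r s t) =
      T (f₀ ∘ slotMap (r ∘ Tuple.sort r) (s ∘ Tuple.sort s) (t ∘ Tuple.sort t))
        (f₁ ∘ slotMap (r ∘ Tuple.sort r) (s ∘ Tuple.sort s) (t ∘ Tuple.sort t))
        (f₂ ∘ slotMap (r ∘ Tuple.sort r) (s ∘ Tuple.sort s) (t ∘ Tuple.sort t)) := by
  rw [← T_comp_axes (Tuple.sort r) (Tuple.sort s) (Tuple.sort t)]
  rfl

omit [Fintype α] [Fintype β] [Fintype γ] in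
/-- A pull-back along monotone slot maps of a monotone function is monotone on the slot grid. [this work] -/
theorem monotone_comp_slotMap {r : Fin 3 → α} {s : Fin 3 → β} {t : Fin 3 → γ} (hr : Monotone r) (hs : Monotone s)
    (ht : Monotone t) {f : α × β × γ → ℝ} (hf : Monotone f) : Monotone (f ∘ slotMap r s t) := by
  intro z z' h
  apply hf
  simp only [slotMap_apply, Prod.mk_le_mk]
  exact ⟨hr h.1, hs h.2.1, ht h.2.2⟩

/-- **SAHI'S `C₃` IN DIMENSION THREE, modulo the slot positivity.**  If `T ≥ 0` on all indicator triples of down-sets of the `3×3×3` slot grid (the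
content of the kernel certificate `SahiThreeChain.slotPhi_nonneg_canon` of `…SlotCertificate`; identification pending), then for all finite chains `α, β, γ`,
all probability vectors `ν, ν′, ν″` and all nonnegative monotone `f₀, f₁, f₂ : α × β × γ → ℝ`:  `0 ≤ E₃^{ν⊗ν′⊗ν″}(f₀,f₁,f₂)`. [this work] -/
theorem sahiE_three_nonneg_prodWeight3_of_slotPos
    (hpos : ∀ U V W : Finset P, IsLowerSet ((U : Finset P) : Set P) → IsLowerSet ((V : Finset P) : Set P) →
      IsLowerSet ((W : Finset P) : Set P) → 0 ≤ T (setInd U) (setInd V) (setInd W))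
    (ν : α → ℝ) (ν' : β → ℝ) (ν'' : γ → ℝ) (hν₀ : ∀ x, 0 ≤ ν x) (hν'₀ : ∀ y, 0 ≤ ν' y) (hν''₀ : ∀ u, 0 ≤ ν'' u)
    (hν : ∑ x, ν x = 1) (hν' : ∑ y, ν' y = 1) (hν'' : ∑ u, ν'' u = 1)
    (f : Fin 3 → α × β × γ → ℝ) (hf₀ : ∀ i p, 0 ≤ f i p) (hfm : ∀ i, Monotone (f i)) :
    0 ≤ sahiE (prodWeight3 ν ν' ν'') 3 f := by
  rw [sahiE_three_prodWeight3_eq ν ν' ν'' hν hν' hν'' f]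
  refine mul_nonneg (by norm_num) (Finset.sum_nonneg fun r _ => Finset.sum_nonneg fun s _ => Finset.sum_nonneg fun t _ => ?_)
  refine mul_nonneg ?_ ?_
  · unfold slotWeight
    exact mul_nonneg (Finset.prod_nonneg fun j _ => hν₀ _)
      (mul_nonneg (Finset.prod_nonneg fun j _ => hν'₀ _) (Finset.prod_nonneg fun j _ => hν''₀ _))
  · rw [T_slotMap_sort]
    have hr := Tuple.monotone_sort r
    have hs := Tuple.monotone_sort s
    have ht := Tuple.monotone_sort t
    exact T_nonneg_of_monotone hpos _ _ _ (fun z => hf₀ 0 _) (fun z => hf₀ 1 _) (fun z => hf₀ 2 _)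
      (monotone_comp_slotMap hr hs ht (hfm 0)) (monotone_comp_slotMap hr hs ht (hfm 1)) (monotone_comp_slotMap hr hs ht (hfm 2))

/-- The same, as order-3 Sahi positivity of the triple product weight on the product poset `α × β × γ`. [this work] -/
theorem sahiPositive_three_prodWeight3_of_slotPos
    (hpos : ∀ U V W : Finset P, IsLowerSet ((U : Finset P) : Set P) → IsLowerSet ((V : Finset P) : Set P) →
      IsLowerSet ((W : Finset P) : Set P) → 0 ≤ T (setInd U) (setInd V) (setInd W))
    (ν : α → ℝ) (ν' : β → ℝ) (ν'' : γ → ℝ) (hν₀ : ∀ x, 0 ≤ ν x) (hν'₀ : ∀ y, 0 ≤ ν' y) (hν''₀ : ∀ u, 0 ≤ ν'' u)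
    (hν : ∑ x, ν x = 1) (hν' : ∑ y, ν' y = 1) (hν'' : ∑ u, ν'' u = 1) :
    SahiPositive (prodWeight3 ν ν' ν'') 3 :=
  fun f hf₀ hfm => sahiE_three_nonneg_prodWeight3_of_slotPos hpos ν ν' ν'' hν₀ hν'₀ hν''₀ hν hν' hν'' f hf₀ hfm

/-! ### The unconditional theorems -/

/-- **SAHI'S `C₃` IN DIMENSION THREE (computer-assisted, kernel-checked).**  For all finite chains `α, β, γ`, all probability vectors `ν, ν′, ν″` and all
nonnegative monotone `f₀, f₁, f₂ : α × β × γ → ℝ` (product order):  `0 ≤ E₃^{ν⊗ν′⊗ν″}(f₀,f₁,f₂)`.  The `n = 3` case of Lieb–Sahi's Conjecture 1.1 in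
dimension `3` for all product weights ([LiebSahi2021]: open beyond dimension `2`).  Proof: the order-3 bridge (`…OrderThreeBridge`) + sorting + layer cake (this
file) + the slot positivity `slotPos` (`…SlotPositivity`, from the exhaustive kernel certificate `…SlotCertificate`). [this work] -/
theorem sahiE_three_nonneg_prodWeight3
    (ν : α → ℝ) (ν' : β → ℝ) (ν'' : γ → ℝ) (hν₀ : ∀ x, 0 ≤ ν x) (hν'₀ : ∀ y, 0 ≤ ν' y) (hν''₀ : ∀ u, 0 ≤ ν'' u)
    (hν : ∑ x, ν x = 1) (hν' : ∑ y, ν' y = 1) (hν'' : ∑ u, ν'' u = 1)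
    (f : Fin 3 → α × β × γ → ℝ) (hf₀ : ∀ i p, 0 ≤ f i p) (hfm : ∀ i, Monotone (f i)) :
    0 ≤ sahiE (prodWeight3 ν ν' ν'') 3 f :=
  sahiE_three_nonneg_prodWeight3_of_slotPos slotPos ν ν' ν'' hν₀ hν'₀ hν''₀ hν hν' hν'' f hf₀ hfm

/-- **Order-3 Sahi positivity of every triple product weight on a product of three finite chains.** [this work] -/
theorem sahiPositive_three_prodWeight3
    (ν : α → ℝ) (ν' : β → ℝ) (ν'' : γ → ℝ) (hν₀ : ∀ x, 0 ≤ ν x) (hν'₀ : ∀ y, 0 ≤ ν' y) (hν''₀ : ∀ u, 0 ≤ ν'' u)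
    (hν : ∑ x, ν x = 1) (hν' : ∑ y, ν' y = 1) (hν'' : ∑ u, ν'' u = 1) :
    SahiPositive (prodWeight3 ν ν' ν'') 3 :=
  sahiPositive_three_prodWeight3_of_slotPos slotPos ν ν' ν'' hν₀ hν'₀ hν''₀ hν hν' hν''

end Assembly

end SahiThreeChain

end Summit.CriticalPhenomena.PercolationContinuityZ3.Theorems
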